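import Literature.ModelTheory.ExponentialFields.DefinablyCompleteSignSets
import Mathlib.Algebra.Polynomial.Bivariate
import HarnessLib

/-!
# The exp-simple quantifier-free fragment is o-minimal in every model of `OEF ∪ [DC]`

Topic `Literature/ModelTheory/ExponentialFields`.  O-minimality of all models of a recursive
subtheory of `Th(ℝ_exp)` is the semantic engine of the Fornasiero–Servi / Jones–Servi route to
Macintyre–Wilkie's theorem (Fornasiero–Servi 2010, Thm. 8.2 / Cor. 8.3: the models of
`[OF] + [DCB] + [exp' = exp]` are o-minimal; Berarducci–Servi 2004, Cor. 2.5).  For the recursive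
theory `OEFDC = OEF ∪ [DC]` (`OEFDefinablyCompleteZeros.lean`) this file proves the fragment of
that statement which the one-variable Khovanskii bound of `DefinablyCompleteExpPolynomials.lean`
controls: **every quantifier-free formula `φ(ȳ; x)` of `L_exp` whose terms are *exp-simple in
`x`* — built from `x`, arbitrary `x`-free terms (parameters), `+`, `·`, `-` and `exp x` — defines,
for all parameters, a finite union of points and open intervals in every model of `OEFDC`**
(`OEFDCModel.isFiniteUnionOfIntervals_setOf_realize`; for definably complete models of `OEF`,
`OEFModel.isFiniteUnionOfIntervals_setOf_realize`).

* `UnaryExpPoly.IsExpSimple` — the exp-simple terms in the variable `x` (an inductive predicate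
  on `L_exp`-terms in `α ⊕ Fin 1`); `IsExpSimple.exists_bivariate`: in a model `K` of `OEF` such a
  term is `R(x, exp x)` for a bivariate polynomial `R ∈ K[X][Y]` (parameters plugged in);
* `UnaryExpPoly.eval_coeff_eq_evalEval` — `R(x, exp x)` is the one-variable exponential
  polynomial with coefficient family `(R.coeff j)_j`, so the zero / sign set theorems of
  `DefinablyCompleteSignSets.lean` apply;
* `UnaryExpPoly.IsSimpleQF` — quantifier-free formulas in `x` with exp-simple atoms
  (`⊥`, `t = s`, `t ≤ s`, `→`), and the o-minimality statement for them by induction (Boolean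
  combinations of finite unions of intervals).

Everything is proved; the definitions are the two syntactic predicates.

## References

* A. Fornasiero, T. Servi, *Definably complete Baire structures*, Fund. Math. 209 (2010),
  Theorem 7.7, Theorem 8.2, Corollary 8.3. [FornasieroServi2010]
* A. Berarducci, T. Servi, Ann. Pure Appl. Logic 125 (2004), Corollary 2.5. [BerarducciServi2004]
* L. van den Dries, *Tame topology and o-minimal structures* (1998), Ch. 1 (3.2). [Dries1998]
-/

noncomputable section

open Set FirstOrder FirstOrder.Language FirstOrder.Language.Structure Polynomial
open scoped FirstOrder Polynomial.Bivariate

namespace Literature.ModelTheory.ExponentialFields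

universe w

namespace UnaryExpPoly

/-! ### Bivariate polynomials evaluated at `(x, E x)` are one-variable exponential polynomials -/

section Bivariate

variable {K : Type*} [Field K]

/-- `R(x, E x) = Σ_{j ≤ deg_Y R} R_j(x) E(x)^j`: a bivariate polynomial evaluated at `(x, E x)` is
the one-variable exponential polynomial with coefficient family `(R.coeff j)_j`. [folklore] -/
theorem eval_coeff_eq_evalEval (E : K → K) (R : K[X][Y]) (x : K) :
    eval E (fun j => R.coeff j) (R.natDegree + 1) x = R.evalEval x (E x) := by
  unfold eval
  rw [Polynomial.evalEval, Polynomial.eval_eq_sum_range (p := R) (C (E x)), eval_finsetSum]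
  refine Finset.sum_congr rfl fun j _ => ?_
  rw [eval_mul, eval_pow, eval_C]

/-- A nonzero bivariate polynomial has a nonzero coefficient below `deg_Y R + 1`. [folklore] -/
theorem exists_coeff_ne_zero {R : K[X][Y]} (hR : R ≠ 0) :
    ∃ j < R.natDegree + 1, (fun j => R.coeff j) j ≠ 0 :=
  ⟨R.natDegree, Nat.lt_succ_self _, leadingCoeff_ne_zero.2 hR⟩

end Bivariate

/-! ### Exp-simple terms -/

/-- **Exp-simple terms in the variable `x`** (the last variable, `Sum.inr 0`): generated from
`x`-free terms (parameters, constants), the variable `x`, `+`, `·`, `-`, and `exp x`.  These are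
exactly the terms whose values are polynomial in `x` and `exp x`. [folklore] -/
inductive IsExpSimple {α : Type*} : Language.orderedExpRing.Term (α ⊕ Fin 1) → Prop
  | const (s : Language.orderedExpRing.Term α) : IsExpSimple (s.relabel Sum.inl)
  | varX : IsExpSimple (var (Sum.inr 0))
  | add {t s : Language.orderedExpRing.Term (α ⊕ Fin 1)} :
      IsExpSimple t → IsExpSimple s → IsExpSimple (t + s)
  | mul {t s : Language.orderedExpRing.Term (α ⊕ Fin 1)} :
      IsExpSimple t → IsExpSimple s → IsExpSimple (t * s)
  | neg {t : Language.orderedExpRing.Term (α ⊕ Fin 1)} : IsExpSimple t → IsExpSimple (-t)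
  | expX : IsExpSimple (Language.orderedExpRing.termExp (var (Sum.inr 0)))

/-- **Quantifier-free formulas in `x` with exp-simple atoms**: `⊥`, `t = s`, `t ≤ s` for
exp-simple `t, s`, closed under `→` (hence under all Boolean connectives, `∼φ = φ → ⊥`,
`φ ⊓ ψ = ∼(φ → ∼ψ)`, and `t < s = t ≤ s ⊓ ∼(s ≤ t)`). [folklore] -/
inductive IsSimpleQF {α : Type*} : Language.orderedExpRing.BoundedFormula α 1 → Prop
  | falsum : IsSimpleQF ⊥
  | equal {t s : Language.orderedExpRing.Term (α ⊕ Fin 1)} :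
      IsExpSimple t → IsExpSimple s → IsSimpleQF (t.bdEqual s)
  | le {t s : Language.orderedExpRing.Term (α ⊕ Fin 1)} :
      IsExpSimple t → IsExpSimple s → IsSimpleQF (t.le s)
  | imp {φ ψ : Language.orderedExpRing.BoundedFormula α 1} :
      IsSimpleQF φ → IsSimpleQF ψ → IsSimpleQF (φ.imp ψ)

/-! ### Their values in a model of `OEF` -/

section Model

variable (K : Language.Theory.ModelType.{0, 0, w} Theory.OEF) {α : Type*}

/-- **An exp-simple term is a bivariate polynomial in `(x, exp x)`** over the model, once the
parameters are plugged in. [folklore] -/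
theorem IsExpSimple.exists_bivariate {t : Language.orderedExpRing.Term (α ⊕ Fin 1)}
    (ht : IsExpSimple t) (v : α → K) :
    ∃ R : (K : Type w)[X][Y], ∀ x : K,
      t.realize (Sum.elim v ![x]) = R.evalEval x (OEFModel.exp x) := by
  induction ht with
  | const s =>
    refine ⟨CC (s.realize v), fun x => ?_⟩
    rw [Term.realize_relabel, Sum.elim_comp_inl, evalEval_CC]
  | varX =>
    refine ⟨C X, fun x => ?_⟩
    rw [evalEval_C, eval_X]
    simp
  | add _ _ iht ihs =>
    obtain ⟨R, hR⟩ := iht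
    obtain ⟨S, hS⟩ := ihs
    exact ⟨R + S, fun x => by rw [OEFModel.realize_add, hR, hS, evalEval_add]⟩
  | mul _ _ iht ihs =>
    obtain ⟨R, hR⟩ := iht
    obtain ⟨S, hS⟩ := ihs
    exact ⟨R * S, fun x => by rw [OEFModel.realize_mul, hR, hS, evalEval_mul]⟩
  | neg _ iht =>
    obtain ⟨R, hR⟩ := iht
    exact ⟨-R, fun x => by rw [OEFModel.realize_neg, hR, evalEval_neg]⟩
  | expX =>
    refine ⟨Y, fun x => ?_⟩
    rw [OEFModel.realize_termExp, evalEval_X]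
    simp

/-- **The zero set of an exp-simple term is a finite union of intervals** in every definably
complete model of `OEF` (finite, or everything). [cite: FornasieroServi2010, Theorem 8.2] -/
theorem _root_.Literature.ModelTheory.ExponentialFields.OEFModel.isFiniteUnionOfIntervals_setOf_simple_eq_zero
    (hDC : Language.orderedExpRing.IsDefinablyComplete K)
    {t : Language.orderedExpRing.Term (α ⊕ Fin 1)} (ht : IsExpSimple t) (v : α → K) :
    IsFiniteUnionOfIntervals {x : K | t.realize (Sum.elim v ![x]) = 0} := by
  obtain ⟨R, hR⟩ := ht.exists_bivariate K v
  have h := OEFModel.isFiniteUnionOfIntervals_setOf_unaryExpPoly_eq_zero K hDC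
    (fun j => R.coeff j) (R.natDegree + 1)
  refine (congrArg _ ?_).mpr h
  ext x
  rw [mem_setOf_eq, mem_setOf_eq, hR x, eval_coeff_eq_evalEval]

/-- **The nonnegativity set of an exp-simple term is a finite union of intervals** in every
definably complete model of `OEF`. [cite: FornasieroServi2010, Theorem 8.2] -/
theorem _root_.Literature.ModelTheory.ExponentialFields.OEFModel.isFiniteUnionOfIntervals_setOf_simple_nonneg
    (hDC : Language.orderedExpRing.IsDefinablyComplete K)
    {t : Language.orderedExpRing.Term (α ⊕ Fin 1)} (ht : IsExpSimple t) (v : α → K) :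
    IsFiniteUnionOfIntervals {x : K | 0 ≤ t.realize (Sum.elim v ![x])} := by
  obtain ⟨R, hR⟩ := ht.exists_bivariate K v
  have h := OEFModel.isFiniteUnionOfIntervals_setOf_unaryExpPoly_nonneg K hDC
    (fun j => R.coeff j) (R.natDegree + 1)
  refine (congrArg _ ?_).mpr h
  ext x
  rw [mem_setOf_eq, mem_setOf_eq, hR x, eval_coeff_eq_evalEval]

/-- **The positivity set of an exp-simple term is a finite union of intervals** in every
definably complete model of `OEF`. [cite: FornasieroServi2010, Theorem 8.2] -/
theorem _root_.Literature.ModelTheory.ExponentialFields.OEFModel.isFiniteUnionOfIntervals_setOf_simple_pos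
    (hDC : Language.orderedExpRing.IsDefinablyComplete K)
    {t : Language.orderedExpRing.Term (α ⊕ Fin 1)} (ht : IsExpSimple t) (v : α → K) :
    IsFiniteUnionOfIntervals {x : K | 0 < t.realize (Sum.elim v ![x])} := by
  obtain ⟨R, hR⟩ := ht.exists_bivariate K v
  have h := OEFModel.isFiniteUnionOfIntervals_setOf_unaryExpPoly_pos K hDC
    (fun j => R.coeff j) (R.natDegree + 1)
  refine (congrArg _ ?_).mpr h
  ext x
  rw [mem_setOf_eq, mem_setOf_eq, hR x, eval_coeff_eq_evalEval]

/-- **O-minimality of the exp-simple quantifier-free fragment in the definably complete models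
of `OEF`**: every quantifier-free formula in `x` with exp-simple atoms defines, for all
parameters, a finite union of points and open intervals (atoms by the preceding theorems applied
to differences of terms; `→` by Boolean closure, van den Dries 1998, Ch. 1, (3.2)).
[cite: FornasieroServi2010, Theorem 8.2] -/
theorem _root_.Literature.ModelTheory.ExponentialFields.OEFModel.isFiniteUnionOfIntervals_setOf_realize
    (hDC : Language.orderedExpRing.IsDefinablyComplete K)
    {φ : Language.orderedExpRing.BoundedFormula α 1} (hφ : IsSimpleQF φ) (v : α → K) :
    IsFiniteUnionOfIntervals {x : K | φ.Realize v ![x]} := by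
  induction hφ with
  | falsum =>
    have hempty : {x : K | (⊥ : Language.orderedExpRing.BoundedFormula α 1).Realize v ![x]} = ∅ := by
      ext x
      simp
    rw [hempty]
    exact isFiniteUnionOfIntervals_empty
  | @equal t s ht hs =>
    have h := OEFModel.isFiniteUnionOfIntervals_setOf_simple_eq_zero K hDC (ht.add hs.neg) v
    refine (congrArg _ ?_).mpr h
    ext x
    simp only [mem_setOf_eq, BoundedFormula.realize_bdEqual, OEFModel.realize_add,
      OEFModel.realize_neg]
    rw [← sub_eq_add_neg, sub_eq_zero]
  | @le t s ht hs =>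
    have h := OEFModel.isFiniteUnionOfIntervals_setOf_simple_nonneg K hDC (hs.add ht.neg) v
    refine (congrArg _ ?_).mpr h
    ext x
    simp only [mem_setOf_eq, Term.realize_le, OEFModel.realize_add, OEFModel.realize_neg]
    rw [← sub_eq_add_neg, sub_nonneg]
  | imp _ _ ihφ ihψ =>
    have h := ihφ.compl.union ihψ
    refine (congrArg _ ?_).mpr h
    ext x
    simp only [mem_setOf_eq, BoundedFormula.realize_imp, mem_union, mem_compl_iff]
    exact imp_iff_not_or

end Model

/-! ### … and in the models of `OEFDC` -/

/-- **O-minimality of the exp-simple quantifier-free fragment in every model of the recursive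
theory `OEFDC = OEF ∪ [DC] ⊆ Th(ℝ_exp)`.** [cite: FornasieroServi2010, Corollary 8.3] -/
theorem _root_.Literature.ModelTheory.ExponentialFields.OEFDCModel.isFiniteUnionOfIntervals_setOf_realize
    (M : Language.Theory.ModelType.{0, 0, w} Theory.OEFDC) {α : Type*}
    {φ : Language.orderedExpRing.BoundedFormula α 1} (hφ : IsSimpleQF φ)
    (v : α → OEFDCModel.toOEF M) :
    IsFiniteUnionOfIntervals {x : OEFDCModel.toOEF M | φ.Realize v ![x]} :=
  OEFModel.isFiniteUnionOfIntervals_setOf_realize (OEFDCModel.toOEF M)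
    (OEFDCModel.isDefinablyComplete M) hφ v

end UnaryExpPoly

end Literature.ModelTheory.ExponentialFields
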